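import Summits.CriticalPhenomena.CardyFormulaZ2.Theorems.CardyIKTransportIKMixedBoxCrossingTransportLinkDefs

/-!
# Stub `stub_linkHonCount` (H2 of the link decomposition; line `defect-closure-exploration`, reshape v5b,
# crux `IKMixedBoxCrossing`, stmt-CriticalPhenomena-5911)

Support file (`--supports stmt-CriticalPhenomena-5911`): the HONEYCOMB COUNT `LinkHonCount` (proofs only, no new
definitions).

Through a honeycomb last face column the face weight is `faceWeight false odd anti = if anti then 1 else 0`, so
only the all-anti-diagonal flags `f ≡ true` carry weight (weight `1`, `sum_flags`), and for these flags gap `i` of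
the necklace `N` is crossed by the new column `c` iff `c` is black on the `gapLen i + 1` CROSSING CELLS
`S i := row '' [gapStart i - 1, gapStart i + gapLen i)` (`cross_true_iff`).  These cell sets are pairwise disjoint
(`cells_disjoint`: block `i` ends at `gapStart i + gapLen i ≤ runStart j` for `i < j`, `blockEnd_le_runStart`, and
`o ↦ row o` is injective below `L`, `row_inj`) and have `gapLen i + 1` elements (`card_cells`).

COUNTING by inclusion–exclusion, for an abstract family `S` of pairwise disjoint cell sets of sizes `gapLen i + 1`
characterising the crossings (no product decomposition of the configuration space is needed): with
`B i c := ∏_{a ∈ S i} [c a]` the indicator of the event `crossVec c true = x` is `∏_i (u (x i) + v (x i) * B i c)`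
(`u b = if b then 0 else 1`, `v b = if b then 1 else -1`; `ind_eq`); expanding the product over the subsets `t` of
indices (`Fintype.prod_add`) leaves the sums
`∑_c ∏_{i ∈ tᶜ} B i c = ∑_c ∏_{a ∈ U} [c a] = 2^L · ∏_{i ∈ tᶜ} (1/2)^(gapLen i + 1)`,
`U` the union of the `S i`, `i ∈ tᶜ` (`sum_prod_black`: a per-cell Fubini `Fintype.prod_sum`;
`sum_prod_blackInd`), and re-summing the binomial
expansion gives `2^L · ∏_i (u (x i) + v (x i) * piG (gapLen i)) = 2^L · ∏_i pG (gapLen i) (x i) = 2^L · honW x`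
(`count_eq`).
-/

noncomputable section

namespace Summit.CriticalPhenomena.CardyFormulaZ2.Cruxes.IKMixedBoxCrossing.DefectClosureExploration

open scoped BigOperators Classical
open Finset
open Summit.CriticalPhenomena.CardyFormulaZ2.Theorems.IKLinearTransport.PinnedDiagramExchange (faceWeight)

namespace LinkHonCountStub

variable {L : ℕ} (N : Necklace L)

/-! ## §1 Necklace geometry: block ends, the crossing cells of a gap, disjointness -/

/-- The end of block `i` (one past the last cell of its gap) is the total length of the blocks `j ≤ i`. -/
theorem blockEnd_eq (i : Fin N.k) :
    N.gapStart i + N.gapLen i =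
      ∑ j ∈ Finset.univ.filter (fun j : Fin N.k => j ≤ i), (N.runLen j + N.gapLen j) := by
  have hsplit : Finset.univ.filter (fun j : Fin N.k => j ≤ i) =
      insert i (Finset.univ.filter (fun j : Fin N.k => j < i)) := by
    ext j
    simp only [Finset.mem_filter, Finset.mem_univ, true_and, Finset.mem_insert]
    rw [Fin.le_def, Fin.lt_def, Fin.ext_iff]
    omega
  rw [hsplit, Finset.sum_insert (by simp), Necklace.gapStart, Necklace.runStart]
  ring

/-- Blocks are laid out in order: block `i` ends before the run of any later block `j` starts. -/
theorem blockEnd_le_runStart {i j : Fin N.k} (h : i < j) : N.gapStart i + N.gapLen i ≤ N.runStart j := by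
  rw [blockEnd_eq]
  unfold Necklace.runStart
  exact Finset.sum_le_sum_of_subset fun l hl => by
    simp only [Finset.mem_filter, Finset.mem_univ, true_and] at hl ⊢
    exact lt_of_le_of_lt hl h

/-- Every block ends at an offset `≤ L`. -/
theorem blockEnd_le (i : Fin N.k) : N.gapStart i + N.gapLen i ≤ L := by
  rw [blockEnd_eq]
  calc ∑ j ∈ Finset.univ.filter (fun j : Fin N.k => j ≤ i), (N.runLen j + N.gapLen j)
      ≤ ∑ j, (N.runLen j + N.gapLen j) := Finset.sum_le_sum_of_subset (Finset.filter_subset _ _)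
    _ = L := N.total

/-- Gaps start at positive offsets (the run below is non-empty). -/
theorem one_le_gapStart (i : Fin N.k) : 1 ≤ N.gapStart i := by
  unfold Necklace.gapStart
  have := N.run_pos i
  omega

/-- `o ↦ N.row o` is injective on the offsets `< L`. -/
theorem row_inj {o o' : ℕ} (ho : o < L) (ho' : o' < L) (h : N.row o = N.row o') : o = o' := by
  have h1 : (o : ZMod L) = (o' : ZMod L) := add_left_cancel h
  have h2 := congrArg ZMod.val h1
  rwa [ZMod.val_cast_of_lt ho, ZMod.val_cast_of_lt ho'] at h2

/-- The crossing cells `row '' [gapStart i - 1, gapStart i + gapLen i)` of gap `i` are `gapLen i + 1` distinct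
cells. -/
theorem card_cells (i : Fin N.k) :
    ((Finset.Ico (N.gapStart i - 1) (N.gapStart i + N.gapLen i)).image N.row).card = N.gapLen i + 1 := by
  have h1 := one_le_gapStart N i
  have h2 := blockEnd_le N i
  rw [Finset.card_image_of_injOn, Nat.card_Ico]
  · omega
  · intro o ho o' ho' h
    simp only [Finset.coe_Ico, Set.mem_Ico] at ho ho'
    exact row_inj N (by omega) (by omega) h

/-- The crossing cells of an earlier gap are disjoint from those of a later gap. -/
theorem cells_disjoint_of_lt {i j : Fin N.k} (h : i < j) :
    Disjoint ((Finset.Ico (N.gapStart i - 1) (N.gapStart i + N.gapLen i)).image N.row)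
      ((Finset.Ico (N.gapStart j - 1) (N.gapStart j + N.gapLen j)).image N.row) := by
  rw [Finset.disjoint_left]
  intro a hai haj
  simp only [Finset.mem_image, Finset.mem_Ico] at hai haj
  obtain ⟨o, ⟨ho1, ho2⟩, rfl⟩ := hai
  obtain ⟨o', ⟨ho1', ho2'⟩, ho⟩ := haj
  have h1 := blockEnd_le_runStart N h
  have h2 := blockEnd_le N j
  have h3 : N.runStart j ≤ N.gapStart j - 1 := by
    unfold Necklace.gapStart
    have := N.run_pos j
    omega
  have h4 := row_inj N (by omega) (by omega) ho
  omega

/-- The crossing cells of distinct gaps are disjoint. -/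
theorem cells_disjoint (i j : Fin N.k) (hij : i ≠ j) :
    Disjoint ((Finset.Ico (N.gapStart i - 1) (N.gapStart i + N.gapLen i)).image N.row)
      ((Finset.Ico (N.gapStart j - 1) (N.gapStart j + N.gapLen j)).image N.row) := by
  rcases lt_or_gt_of_ne hij with h | h
  · exact cells_disjoint_of_lt N h
  · exact (cells_disjoint_of_lt N h).symm

/-- With all flags `true` (anti-diagonals), gap `i` is crossed iff the new column is black on its crossing cells. -/
theorem cross_true_iff (c : ZMod L → Bool) (i : Fin N.k) :
    N.cross c (fun _ => true) i = true ↔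
      ∀ a ∈ (Finset.Ico (N.gapStart i - 1) (N.gapStart i + N.gapLen i)).image N.row, c a = true := by
  rw [Finset.forall_mem_image]
  simp only [Necklace.cross, Necklace.InGap, decide_eq_true_eq, Bool.true_eq_false, or_false, or_true,
    and_true, Finset.mem_Ico, and_imp]
  constructor
  · rintro ⟨hA, hB⟩ o ho1 ho2
    by_cases ho : N.gapStart i ≤ o
    · exact hA o ho ho2
    · have : o = N.gapStart i - 1 := by omega
      rw [this]
      exact hB
  · intro h
    have hg := N.gap_pos i
    exact ⟨fun o ho1 ho2 => h (by omega) ho2, h le_rfl (by omega)⟩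

/-! ## §2 Counting, for an abstract family `S` of crossing cell sets -/

/-- The honeycomb gap weight in affine form: `pG g b = u b + v b * piG g` with `u b = [b = false]`,
`v b = ±1`. -/
theorem pG_eq (g : ℕ) (b : Bool) :
    pG g b = (if b then (0 : ℝ) else 1) + (if b then (1 : ℝ) else -1) * piG g := by
  cases b
  · simp only [pG, Bool.false_eq_true, if_false]
    ring
  · simp only [pG, if_true]
    ring

variable (S : Fin N.k → Finset (ZMod L))

/-- If crossing gap `i` means "black on `S i`", the indicator of a prescribed crossing value of gap `i` is affine
in the black indicator `∏_{a ∈ S i} [c a]` (same coefficients as `pG_eq`). -/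
theorem ind_eq
    (hcross : ∀ (c : ZMod L → Bool) (i : Fin N.k), N.cross c (fun _ => true) i = true ↔ ∀ a ∈ S i, c a = true)
    (x : Fin N.k → Bool) (c : ZMod L → Bool) (i : Fin N.k) :
    (if N.cross c (fun _ => true) i = x i then (1 : ℝ) else 0) =
      (if x i then (0 : ℝ) else 1) +
        (if x i then (1 : ℝ) else -1) * ∏ a ∈ S i, (if c a = true then (1 : ℝ) else 0) := by
  rw [Finset.prod_boole]
  by_cases hall : ∀ a ∈ S i, c a = true
  · rw [(hcross c i).2 hall, if_pos hall]
    cases x i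
    · simp
    · simp
  · have hc : N.cross c (fun _ => true) i = false := by
      simpa using mt (hcross c i).1 hall
    rw [hc, if_neg hall]
    cases x i
    · simp
    · simp

section Count

variable [NeZero L]

/-- The number of columns black on a prescribed cell set `W` is `2^L · (1/2)^{#W}` (per-cell Fubini). -/
theorem sum_prod_black (W : Finset (ZMod L)) :
    (∑ c : ZMod L → Bool, ∏ a ∈ W, (if c a = true then (1 : ℝ) else 0)) =
      (2 : ℝ) ^ L * ∏ _a ∈ W, (1 / 2 : ℝ) := by
  have h1 : ∀ c : ZMod L → Bool, ∏ a ∈ W, (if c a = true then (1 : ℝ) else 0) =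
      ∏ a, (if a ∈ W then (if c a = true then (1 : ℝ) else 0) else 1) := fun c =>
    (Fintype.prod_ite_mem W fun a => if c a = true then (1 : ℝ) else 0).symm
  have h2 : ∀ a : ZMod L, (∑ b : Bool, if a ∈ W then (if b = true then (1 : ℝ) else 0) else 1) =
      2 * (if a ∈ W then (1 / 2 : ℝ) else 1) := by
    intro a
    rw [Fintype.sum_bool]
    by_cases ha : a ∈ W
    · simp only [ha, if_true, Bool.false_eq_true, if_false]
      norm_num
    · simp only [ha, if_false]
      norm_num
  simp_rw [h1]
  rw [show (∑ c : ZMod L → Bool, ∏ a, (if a ∈ W then (if c a = true then (1 : ℝ) else 0) else 1)) =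
      ∏ a, ∑ b : Bool, (if a ∈ W then (if b = true then (1 : ℝ) else 0) else 1) from
    (Fintype.prod_sum fun (a : ZMod L) (b : Bool) => if a ∈ W then (if b = true then (1 : ℝ) else 0) else 1).symm]
  simp_rw [h2]
  rw [Finset.prod_mul_distrib, Finset.prod_const, Finset.card_univ, ZMod.card,
    Fintype.prod_ite_mem W fun _ => (1 / 2 : ℝ)]

/-- For pairwise disjoint cell sets `S i` of sizes `gapLen i + 1`, the number of columns black on all the `S i`,
`i ∈ V`, is `2^L · ∏_{i ∈ V} piG (gapLen i)`. -/
theorem sum_prod_blackInd (hdisj : ∀ i j, i ≠ j → Disjoint (S i) (S j))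
    (hcard : ∀ i, (S i).card = N.gapLen i + 1) (V : Finset (Fin N.k)) :
    (∑ c : ZMod L → Bool, ∏ i ∈ V, ∏ a ∈ S i, (if c a = true then (1 : ℝ) else 0)) =
      (2 : ℝ) ^ L * ∏ i ∈ V, piG (N.gapLen i) := by
  have hd : (V : Set (Fin N.k)).PairwiseDisjoint S := fun i _ j _ hij => hdisj i j hij
  have h1 : ∀ c : ZMod L → Bool, ∏ i ∈ V, ∏ a ∈ S i, (if c a = true then (1 : ℝ) else 0) =
      ∏ a ∈ V.biUnion S, (if c a = true then (1 : ℝ) else 0) := fun c =>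
    (Finset.prod_biUnion hd).symm
  simp_rw [h1]
  rw [sum_prod_black, Finset.prod_biUnion hd]
  congr 1
  refine Finset.prod_congr rfl fun i _ => ?_
  rw [Finset.prod_const, hcard, piG]

/-- THE COUNT: if the crossings through a honeycomb column are "black on `S i`" for pairwise disjoint cell sets
`S i` of sizes `gapLen i + 1`, the number of new columns whose crossing vector is `x` is `2^L · honW x`. -/
theorem count_eq (hdisj : ∀ i j, i ≠ j → Disjoint (S i) (S j)) (hcard : ∀ i, (S i).card = N.gapLen i + 1)
    (hcross : ∀ (c : ZMod L → Bool) (i : Fin N.k), N.cross c (fun _ => true) i = true ↔ ∀ a ∈ S i, c a = true)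
    (x : Fin N.k → Bool) :
    (∑ c : ZMod L → Bool, if N.crossVec c (fun _ => true) = x then (1 : ℝ) else 0) = (2 : ℝ) ^ L * N.honW x := by
  have h1 : ∀ c : ZMod L → Bool, (if N.crossVec c (fun _ => true) = x then (1 : ℝ) else 0) =
      ∑ t : Finset (Fin N.k), (∏ i ∈ t, (if x i then (0 : ℝ) else 1)) *
        ((∏ i ∈ tᶜ, (if x i then (1 : ℝ) else -1)) *
          ∏ i ∈ tᶜ, ∏ a ∈ S i, (if c a = true then (1 : ℝ) else 0)) := by
    intro c
    calc (if N.crossVec c (fun _ => true) = x then (1 : ℝ) else 0)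
        = ∏ i, (if N.cross c (fun _ => true) i = x i then (1 : ℝ) else 0) := by
          rw [Fintype.prod_boole]
          by_cases hx : N.crossVec c (fun _ => true) = x
          · rw [if_pos hx, if_pos (show ∀ i, N.cross c (fun _ => true) i = x i from funext_iff.1 hx)]
          · rw [if_neg hx, if_neg (show ¬ ∀ i, N.cross c (fun _ => true) i = x i from fun h => hx (funext h))]
      _ = ∏ i, ((if x i then (0 : ℝ) else 1) +
            (if x i then (1 : ℝ) else -1) * ∏ a ∈ S i, (if c a = true then (1 : ℝ) else 0)) :=
          Fintype.prod_congr _ _ fun i => ind_eq N S hcross x c i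
      _ = ∑ t : Finset (Fin N.k), (∏ i ∈ t, (if x i then (0 : ℝ) else 1)) *
            ∏ i ∈ tᶜ, ((if x i then (1 : ℝ) else -1) * ∏ a ∈ S i, (if c a = true then (1 : ℝ) else 0)) :=
          Fintype.prod_add _ _
      _ = ∑ t : Finset (Fin N.k), (∏ i ∈ t, (if x i then (0 : ℝ) else 1)) *
            ((∏ i ∈ tᶜ, (if x i then (1 : ℝ) else -1)) *
              ∏ i ∈ tᶜ, ∏ a ∈ S i, (if c a = true then (1 : ℝ) else 0)) := by
          simp_rw [Finset.prod_mul_distrib]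
  have h2 : ∀ t : Finset (Fin N.k), (∑ c : ZMod L → Bool, (∏ i ∈ t, (if x i then (0 : ℝ) else 1)) *
      ((∏ i ∈ tᶜ, (if x i then (1 : ℝ) else -1)) *
        ∏ i ∈ tᶜ, ∏ a ∈ S i, (if c a = true then (1 : ℝ) else 0))) =
        (2 : ℝ) ^ L * ((∏ i ∈ t, (if x i then (0 : ℝ) else 1)) *
          ∏ i ∈ tᶜ, ((if x i then (1 : ℝ) else -1) * piG (N.gapLen i))) := by
    intro t
    rw [← Finset.mul_sum, ← Finset.mul_sum, sum_prod_blackInd N S hdisj hcard tᶜ, Finset.prod_mul_distrib]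
    ring
  simp_rw [h1]
  rw [Finset.sum_comm]
  simp_rw [h2]
  rw [← Finset.mul_sum, ← Fintype.prod_add]
  simp only [Necklace.honW, pG_eq]

/-- Through a honeycomb face column only the flags `f ≡ true` carry weight, and that weight is `1`. -/
theorem sum_flags (x : Fin N.k → Bool) (c : ZMod L → Bool) :
    (∑ f : ZMod L → Bool, if N.crossVec c f = x then lastColWeight false L N.col c f else 0) =
      if N.crossVec c (fun _ => true) = x then (1 : ℝ) else 0 := by
  have htrue : lastColWeight false L N.col c (fun _ => true) = 1 :=
    Finset.prod_eq_one fun r _ => by simp [faceWeight]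
  have hzero : ∀ f : ZMod L → Bool, f ≠ (fun _ => true) → lastColWeight false L N.col c f = 0 := by
    intro f hf
    obtain ⟨r, hr⟩ := Function.ne_iff.1 hf
    exact Finset.prod_eq_zero (Finset.mem_univ r) (by simp [faceWeight, hr])
  rw [Finset.sum_eq_single_of_mem (fun _ : ZMod L => true) (Finset.mem_univ _) fun f _ hf => by
    rw [hzero f hf, ite_self]]
  rw [htrue]

end Count

end LinkHonCountStub

open LinkHonCountStub in
/-- **STUB · `stub_linkHonCount`** (H2 · HONEYCOMB COUNT): through a honeycomb last face column only the flags
`f ≡ true` carry weight, gap `i` is crossed iff the new column is black on the `gapLen i + 1` crossing cells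
`row '' [gapStart i - 1, gapStart i + gapLen i)` (pairwise disjoint cell sets), and the number of new columns with
crossing pattern `x` is `2^L · ∏_i pG (gapLen i) (x i) = 2^L · honW x`. -/
theorem stub_linkHonCount : LinkHonCount := by
  intro L _ N x
  rw [Fintype.sum_prod_type]
  exact (Finset.sum_congr rfl fun c _ => sum_flags N x c).trans
    (count_eq N (fun i => (Finset.Ico (N.gapStart i - 1) (N.gapStart i + N.gapLen i)).image N.row)
      (cells_disjoint N) (card_cells N) (cross_true_iff N) x)

end Summit.CriticalPhenomena.CardyFormulaZ2.Cruxes.IKMixedBoxCrossing.DefectClosureExploration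

end
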